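import Summits.BirchSwinnertonDyer.Rank1Residual.X11b.Three.KolyvaginShaAnnihilatorThree
import Summits.BirchSwinnertonDyer.Rank1Residual.X11b.Three.KolyvaginShaExponentThree
import Summits.BirchSwinnertonDyer.Rank1Residual.X11b.KolyvaginLeafInputsDischarged
import Literature.NumberTheory.GaloisCohomology.PoitouTateNumberField
import HarnessLib

/-!
# `Ш(E/K)[3^∞]` on the class X11b @ 3 ∩ (KN₃)/ℚ modulo ONE cite-only input `hγ`:
# finite, killed by `3^{ord_3 [E(K) : ℤ y_K]}`, trivial when `3 ∤ y_K`
# (the K-side Kolyvagin ENDs at `3` with `hPT`, `hrec`, `hCM`, `h53` DISCHARGED)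

Cell `b2b-bsdres`, team x11b3 (N8/O2 = X11b @ 3); seat x11b3-p2 GEN 52 (unit claimed D-0075 →
BSD:K2/P4 «Kolyvagin-in-kernel»).  Summit-side THEOREM-ONLY file (no definition, no named fact,
no `sorry`); `K : Type`.

HONEST FRAMING (cell `b2b-bsdres`, run/shared/lean/b2b/bsd-rank1-residual/, verbatim in every
file): the goal of the cell is to DELETE the COMBINATION-SHAPED residual classes of the
Birch–Swinnerton-Dyer formula for ALL analytic-rank `≤ 1` elliptic curves over `ℚ` — "full BSD
formula for every rank `≤ 1` curve in class `C`" assembled STRICTLY from published theorems — so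
that the rank-`≤ 1` remainder becomes exactly the CONSTRUCTION-SHAPED classes, which are TYPED
(missing-input `Prop`s), NOT attempted.  This is not "finishing BSD".  The X11b @ 3 class stays
OPEN; nothing here is booked; no mark / label / count / tier moves.

WHAT THIS FILE DOES.  The K-side class ENDs at `3` of this seat's Kolyvagin telescope —
`Three.sha_primary_finite_three_of_classX11b_of_kodairaNeron_rat'` (FILE 6, p325613: `Ш(E/K)[3^∞]`
finite), `Three.KolyvaginAnnihilator.pow_smul_sha_three_primary_eq_zero_of_classX11b_of_kodairaNeron_rat'`
/ `…_rat_index` ((P2-KOLYC) γ2: `3^{m} · Ш(E/K)[3^∞] = 0` for `3^{m+1} ∤ y_K`, `m = ord_3 [E(K) : ℤ y_K]`)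
and `Three.sha_three_primary_eq_zero_of_classX11b_of_kodairaNeron_rat_of_not_dvd` ((P2-QUANT) C:
`3 ∤ y_K ⟹ Ш(E/K)[3^∞] = 0`) — are each CONDITIONAL on EXACTLY the five labelled cite-only inputs
{`hPT`, `hrec`, `hCM`, `h53`, `hγ`} at `3` + `hN` + (KN₃)/ℚ.  FOUR of the five are now KERNEL
THEOREMS of the tree (2026-08-27): `hPT = GaloisCohomology.poitouTate_sum_localTatePairing_eq_zero_holds K`,
`hrec = heegnerPointOfConductor_one_galoisConj_holds N W K`, `hCM = KolyvaginLeaves.hCM_holds N W K 3`,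
`h53 = KolyvaginLeaves.h53_holds hN 3` (`X11b/KolyvaginLeafInputsDischarged`: Gross §3 CM
rationality and Prop. 5.3 at every Kolyvagin level, from the complex-multiplication theorems
`HeegnerPointsOfConductorRationalityProofs` / `HeegnerPointsOfConductorGaloisOrbitProofs` and this
seat's reduction `KolyvaginA53.h53_of_recM`).  THIS FILE re-issues the four ENDs with those labels
SUPPLIED — every other binder and every conclusion VERBATIM, proof = one application of the parent —
so that on X11b @ 3 ∩ (KN₃)/ℚ (for any imaginary quadratic Heegner field `K` with a non-torsion
Heegner point `y_K`) the finiteness of `Ш(E/K)[3^∞]`, its annihilation by `3^{ord_3 [E(K) : ℤ y_K]}`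
and its vanishing when `3 ∤ y_K` rest on EXACTLY ONE cite-only input at `3`: `hγ` = Gross 1991
Prop. 3.7 (2), the Eichler–Shimura congruence `y_m ≡ Frob(λ)·y_{m/ℓ}` modulo the primes above an
inert Kolyvagin prime (not in the tree: it needs the Eichler–Shimura relation on `X₀(N)` mod `ℓ`).
The ORDER form (`#Ш(E/K)[3^∞] ≤ 3^{2M₀}`, Cassels–Tate inputs) is the sibling
`Three/KolyvaginShaOrderThreeDischarged`; the ℚ-side is `Three/KolyvaginShaThreeRatDischarged`.
Nothing else is claimed; nothing booked.

## What is proved (namespace `Summit.BirchSwinnertonDyer.Rank1Residual.X11b.Three.KolyvaginDischarged`)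

* `sha_primary_finite_three_of_classX11b_of_kodairaNeron_rat` — `Ш(E/K)[3^∞]` finite, modulo {`hγ`} + `hN`.
* `pow_smul_sha_three_primary_eq_zero_of_classX11b_of_kodairaNeron_rat` — `3^{m+1} ∤ y_K ⟹
  3^{m} · Ш(E/K)[3^∞] = 0`, modulo {`hγ`} + `hN`.
* `pow_smul_sha_three_primary_eq_zero_of_classX11b_of_kodairaNeron_rat_index` —
  `3^{ord_3 [E(K) : ℤ y_K]} · Ш(E/K)[3^∞] = 0`, modulo {`hγ`} + `hN`.
* `sha_three_primary_eq_zero_of_classX11b_of_kodairaNeron_rat_of_not_dvd` — `3 ∤ y_K ⟹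
  Ш(E/K)[3^∞] = 0`, modulo {`hγ`} + `hN`.

## References

* [McCallumLMS1991] W. G. McCallum, *Kolyvagin's work on Shafarevich–Tate groups*, LMS LNS 153
  (1991), §1 Theorem (Kolyvagin), Lemma 5.1 (p. 303), §5.
* [GrossLMS1991] B. H. Gross, *Kolyvagin's work on modular elliptic curves*, same volume, Thm. 1.3
  (2), Prop. 2.1 (2), §3 Prop. 3.7 (2), Prop. 5.3, §10.
* [Serre1972] J.-P. Serre, *Propriétés galoisiennes des points d'ordre fini des courbes
  elliptiques*, Invent. Math. 15 (1972), §2.4 Prop. 15. [SilvermanAEC2009] Thm. VII.6.1.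
* [Darmon2004] H. Darmon, CBMS 101, Thm. 3.6, Thm. 3.7.

presearch: `lean search 'KolyvaginDischarged'` → none; parents = the four tree ENDs named above
(this seat, GEN 35–41); dischargers = tree theorems of 2026-08-27 (see
`X11b/KolyvaginLeafInputsDischarged`); [corpus:book:editornd-l-functions-arithmetic chunk 216
(Prop. 3.7)] for the remaining input; nothing minted.
-/

noncomputable section

open scoped Classical
open WeierstrassCurve Field NumberField IsDedekindDomain
open Literature.NumberTheory.EllipticCurves Literature.NumberTheory.GaloisRepresentations
open Literature.NumberTheory.EllipticCurves.Rank1Residual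
open Literature.NumberTheory.EllipticCurves.RingClassField
open Literature.NumberTheory.EllipticCurves.ModularForms
open Literature.NumberTheory.DiophantineGeometry Literature.NumberTheory.DiophantineGeometry.TateAlgorithm
open Literature.NumberTheory.GaloisCohomology (poitouTate_sum_localTatePairing_eq_zero_holds)
open Summit.BirchSwinnertonDyer.Rank1Residual.X11b.KolyvaginAssembly

namespace Summit.BirchSwinnertonDyer.Rank1Residual.X11b.Three.KolyvaginDischarged

-- `K : Type`: the tree's ring-class class field theory is universe `0`.
variable {K : Type} [Field K] [NumberField K] {N : ℕ} {W : WeierstrassCurve ℚ}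

/-- **On the class X11b @ 3 ∩ (KN₃)/ℚ, `Ш(E/K)[3^∞]` is finite — modulo ONE cite-only input `hγ`
at `3`, NO image hypothesis.**  The tree END `Three.sha_primary_finite_three_of_classX11b_of_kodairaNeron_rat'`
(FIVE labels) with `hPT`, `hrec`, `hCM`, `h53` SUPPLIED by `poitouTate_sum_localTatePairing_eq_zero_holds K`,
`heegnerPointOfConductor_one_galoisConj_holds N W K`, `KolyvaginLeaves.hCM_holds N W K 3`,
`KolyvaginLeaves.h53_holds hN 3`.  For `(E, 3) ∈ ClassX11b W 3` at `N = N_E` (`hN`), (KN₃)/ℚ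
(`hKN3m`, `hKN3a`), any `K : Type` imaginary quadratic with the Heegner hypothesis and a non-torsion
Heegner point `P`: `{c ∈ Ш(E/K) | 3^j c = 0}` is finite.  CONDITIONAL on EXACTLY {`hγ`} (Gross
Prop. 3.7 (2) at `3`; cite-only, NOT discharged) + `hN` + (KN₃)/ℚ; nothing booked; no mark / count
/ tier moves. [cite: McCallumLMS1991, §1 Theorem (Kolyvagin)] [cite: GrossLMS1991, Thm. 1.3 (2), §3 Prop. 3.7 (2)]
[cite: Serre1972, §2.4 Prop. 15] -/
theorem sha_primary_finite_three_of_classX11b_of_kodairaNeron_rat [NeZero N]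
    [W.IsGloballyMinimal] (hW : ClassX11b W 3) (hN : ∀ [W.IsElliptic], N = W.conductorNorm ℤ)
    (hKN3m : ∀ [W.IsElliptic] (v : HeightOneSpectrum (𝓞 ℚ)),
      W.HasMultiplicativeReductionAt v → ¬ 3 ∣ W.ordMinimalDiscriminant v)
    (hKN3a : ∀ [W.IsElliptic] (v : HeightOneSpectrum (𝓞 ℚ)), W.HasAdditiveReductionAt v →
      W.kodairaSymbolAt v ≠ KodairaSymbol.IV ∧ W.kodairaSymbolAt v ≠ KodairaSymbol.IVstar)
    (hγ : ∀ [W.IsElliptic] (_hK : IsImaginaryQuadratic K) (_hH : SatisfiesHeegnerHypothesis N K)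
      (Dt : ModularParametrizationData W N) (β : ℤ) (ι : K →+* ℂ) {M : ℕ}
      (_hM : 1 ≤ M) {n : ℕ} (_hn : Squarefree n)
      (_hKol : ∀ q ∈ n.primeFactors, IsKolyvaginPrime N W K 3 q ∧ FrobEqFrobInfty W K (3 ^ M) q)
      (d : (m : ℕ) → m ∣ n → KolyvaginHeegnerData Dt β ι m)
      (m : ℕ) (hm : m ∣ n) (ℓ : ℕ) (hℓ : ℓ ∈ m.primeFactors) [Fact ℓ.Prime]
      (hΔ : ¬ (ℓ : ℤ) ∣ minimalDiscriminantInt W) (φ₀ : absoluteGaloisGroup (ZMod ℓ)),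
      (∀ x : AlgebraicClosure (ZMod ℓ), φ₀ • x = x ^ ℓ) →
      ∀ (hle : ringClassField K ι (m / ℓ) ≤ ringClassField K ι m)
        (γ : ringClassField K ι m ≃ₐ[ℚ] ringClassField K ι m), γ ∈ ringClassGal ι m →
        geomReduction hΔ ((RatClosure.pointsEquiv (K := K) W).symm
            ((d m hm).toGeomPoints (pointGalHom W (ringClassField K ι m) γ (d m hm).y))) =
          φ₀ • geomReduction hΔ ((RatClosure.pointsEquiv (K := K) W).symm
            ((d m hm).toGeomPoints (pointGalHom W (ringClassField K ι m) γ
              (WeierstrassCurve.Affine.Point.map (W' := W)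
                ((RingClassField.inclusion ι hle).restrictScalars ℚ)
                (d (m / ℓ)
                  ((Nat.div_dvd_of_dvd (Nat.dvd_of_mem_primeFactors hℓ)).trans hm)).y))))) :
    ∀ [W.IsElliptic] (_hK : IsImaginaryQuadratic K) (_hH : SatisfiesHeegnerHypothesis N K)
      {P : (W.baseChange K).toAffine.Point} (_hP : IsHeegnerPoint N W K P)
      (_hnt : ¬ IsOfFinAddOrder P),
      Set.Finite {c : (W.baseChange K).sha | ∃ j : ℕ, 3 ^ j • c = 0} :=
  Three.sha_primary_finite_three_of_classX11b_of_kodairaNeron_rat' hW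
    (poitouTate_sum_localTatePairing_eq_zero_holds K) hN
    (heegnerPointOfConductor_one_galoisConj_holds N W K) (KolyvaginLeaves.hCM_holds N W K 3)
    (@fun _ ↦ KolyvaginLeaves.h53_holds hN 3) hKN3m hKN3a hγ

/-- **On the class X11b @ 3 ∩ (KN₃)/ℚ, `3^{m} · Ш(E/K)[3^∞] = 0` for every `m` with `3^{m+1} ∤ y_K`
— modulo ONE cite-only input `hγ` at `3`** (Kolyvagin's annihilator; McCallum §1 Theorem / §5 with
Lemma 5.1).  The tree END
`Three.KolyvaginAnnihilator.pow_smul_sha_three_primary_eq_zero_of_classX11b_of_kodairaNeron_rat'`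
with `hPT`, `hrec`, `hCM`, `h53` SUPPLIED by the tree theorems; every other binder and the
conclusion VERBATIM.  CONDITIONAL on EXACTLY {`hγ`} at `3` + `hN` + (KN₃)/ℚ; nothing booked; no mark.
[cite: McCallumLMS1991, §1 Theorem (Kolyvagin), Lemma 5.1] [cite: GrossLMS1991, Thm. 1.3 (2), §3 Prop. 3.7 (2), §10] -/
theorem pow_smul_sha_three_primary_eq_zero_of_classX11b_of_kodairaNeron_rat [NeZero N]
    [W.IsGloballyMinimal] (hW : ClassX11b W 3) (hN : ∀ [W.IsElliptic], N = W.conductorNorm ℤ)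
    (hKN3m : ∀ [W.IsElliptic] (v : HeightOneSpectrum (𝓞 ℚ)),
      W.HasMultiplicativeReductionAt v → ¬ 3 ∣ W.ordMinimalDiscriminant v)
    (hKN3a : ∀ [W.IsElliptic] (v : HeightOneSpectrum (𝓞 ℚ)), W.HasAdditiveReductionAt v →
      W.kodairaSymbolAt v ≠ KodairaSymbol.IV ∧ W.kodairaSymbolAt v ≠ KodairaSymbol.IVstar)
    (hγ : ∀ [W.IsElliptic] (_hK : IsImaginaryQuadratic K) (_hH : SatisfiesHeegnerHypothesis N K)
      (Dt : ModularParametrizationData W N) (β : ℤ) (ι : K →+* ℂ) {M : ℕ}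
      (_hM : 1 ≤ M) {n : ℕ} (_hn : Squarefree n)
      (_hKol : ∀ q ∈ n.primeFactors, IsKolyvaginPrime N W K 3 q ∧ FrobEqFrobInfty W K (3 ^ M) q)
      (d : (m : ℕ) → m ∣ n → KolyvaginHeegnerData Dt β ι m)
      (m : ℕ) (hm : m ∣ n) (ℓ : ℕ) (hℓ : ℓ ∈ m.primeFactors) [Fact ℓ.Prime]
      (hΔ : ¬ (ℓ : ℤ) ∣ minimalDiscriminantInt W) (φ₀ : absoluteGaloisGroup (ZMod ℓ)),
      (∀ x : AlgebraicClosure (ZMod ℓ), φ₀ • x = x ^ ℓ) →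
      ∀ (hle : ringClassField K ι (m / ℓ) ≤ ringClassField K ι m)
        (γ : ringClassField K ι m ≃ₐ[ℚ] ringClassField K ι m), γ ∈ ringClassGal ι m →
        geomReduction hΔ ((RatClosure.pointsEquiv (K := K) W).symm
            ((d m hm).toGeomPoints (pointGalHom W (ringClassField K ι m) γ (d m hm).y))) =
          φ₀ • geomReduction hΔ ((RatClosure.pointsEquiv (K := K) W).symm
            ((d m hm).toGeomPoints (pointGalHom W (ringClassField K ι m) γ
              (WeierstrassCurve.Affine.Point.map (W' := W)
                ((RingClassField.inclusion ι hle).restrictScalars ℚ)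
                (d (m / ℓ)
                  ((Nat.div_dvd_of_dvd (Nat.dvd_of_mem_primeFactors hℓ)).trans hm)).y))))) :
    ∀ [W.IsElliptic] (_hK : IsImaginaryQuadratic K) (_hH : SatisfiesHeegnerHypothesis N K)
      {P : (W.baseChange K).toAffine.Point} (_hP : IsHeegnerPoint N W K P)
      (_hnt : ¬ IsOfFinAddOrder P) {m : ℕ}
      (_hm : ∀ Q : (W.baseChange K).toAffine.Point, 3 ^ (m + 1) • Q ≠ P) (c : (W.baseChange K).sha),
      (∃ j : ℕ, 3 ^ j • c = 0) → 3 ^ m • c = 0 :=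
  Three.KolyvaginAnnihilator.pow_smul_sha_three_primary_eq_zero_of_classX11b_of_kodairaNeron_rat' hW
    (poitouTate_sum_localTatePairing_eq_zero_holds K) hN
    (heegnerPointOfConductor_one_galoisConj_holds N W K) (KolyvaginLeaves.hCM_holds N W K 3)
    (@fun _ ↦ KolyvaginLeaves.h53_holds hN 3) hKN3m hKN3a hγ

/-- **On the class X11b @ 3 ∩ (KN₃)/ℚ: `3^{ord_3 [E(K) : ℤ y_K]} · Ш(E/K)[3^∞] = 0` — modulo ONE
cite-only input `hγ` at `3`** (the Heegner-INDEX form, McCallum §1 Theorem in exponent form with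
Lemma 5.1, for `[E(K) : ℤ P]` finite — Mathlib's `AddSubgroup.index ≠ 0`).  The tree END
`Three.KolyvaginAnnihilator.pow_smul_sha_three_primary_eq_zero_of_classX11b_of_kodairaNeron_rat_index`
with `hPT`, `hrec`, `hCM`, `h53` SUPPLIED by the tree theorems; binders/conclusion otherwise
VERBATIM.  CONDITIONAL on EXACTLY {`hγ`} at `3` + `hN` + (KN₃)/ℚ; nothing booked; no mark.
[cite: McCallumLMS1991, §1 Theorem (Kolyvagin), Lemma 5.1 (p. 303)] [cite: GrossLMS1991, Thm. 1.3 (2), §3 Prop. 3.7 (2)] -/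
theorem pow_smul_sha_three_primary_eq_zero_of_classX11b_of_kodairaNeron_rat_index [NeZero N]
    [W.IsGloballyMinimal] (hW : ClassX11b W 3) (hN : ∀ [W.IsElliptic], N = W.conductorNorm ℤ)
    (hKN3m : ∀ [W.IsElliptic] (v : HeightOneSpectrum (𝓞 ℚ)),
      W.HasMultiplicativeReductionAt v → ¬ 3 ∣ W.ordMinimalDiscriminant v)
    (hKN3a : ∀ [W.IsElliptic] (v : HeightOneSpectrum (𝓞 ℚ)), W.HasAdditiveReductionAt v →
      W.kodairaSymbolAt v ≠ KodairaSymbol.IV ∧ W.kodairaSymbolAt v ≠ KodairaSymbol.IVstar)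
    (hγ : ∀ [W.IsElliptic] (_hK : IsImaginaryQuadratic K) (_hH : SatisfiesHeegnerHypothesis N K)
      (Dt : ModularParametrizationData W N) (β : ℤ) (ι : K →+* ℂ) {M : ℕ}
      (_hM : 1 ≤ M) {n : ℕ} (_hn : Squarefree n)
      (_hKol : ∀ q ∈ n.primeFactors, IsKolyvaginPrime N W K 3 q ∧ FrobEqFrobInfty W K (3 ^ M) q)
      (d : (m : ℕ) → m ∣ n → KolyvaginHeegnerData Dt β ι m)
      (m : ℕ) (hm : m ∣ n) (ℓ : ℕ) (hℓ : ℓ ∈ m.primeFactors) [Fact ℓ.Prime]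
      (hΔ : ¬ (ℓ : ℤ) ∣ minimalDiscriminantInt W) (φ₀ : absoluteGaloisGroup (ZMod ℓ)),
      (∀ x : AlgebraicClosure (ZMod ℓ), φ₀ • x = x ^ ℓ) →
      ∀ (hle : ringClassField K ι (m / ℓ) ≤ ringClassField K ι m)
        (γ : ringClassField K ι m ≃ₐ[ℚ] ringClassField K ι m), γ ∈ ringClassGal ι m →
        geomReduction hΔ ((RatClosure.pointsEquiv (K := K) W).symm
            ((d m hm).toGeomPoints (pointGalHom W (ringClassField K ι m) γ (d m hm).y))) =
          φ₀ • geomReduction hΔ ((RatClosure.pointsEquiv (K := K) W).symm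
            ((d m hm).toGeomPoints (pointGalHom W (ringClassField K ι m) γ
              (WeierstrassCurve.Affine.Point.map (W' := W)
                ((RingClassField.inclusion ι hle).restrictScalars ℚ)
                (d (m / ℓ)
                  ((Nat.div_dvd_of_dvd (Nat.dvd_of_mem_primeFactors hℓ)).trans hm)).y))))) :
    ∀ [W.IsElliptic] (_hK : IsImaginaryQuadratic K) (_hH : SatisfiesHeegnerHypothesis N K)
      {P : (W.baseChange K).toAffine.Point} (_hP : IsHeegnerPoint N W K P)
      (_hnt : ¬ IsOfFinAddOrder P) (_hidx : (AddSubgroup.zmultiples P).index ≠ 0)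
      (c : (W.baseChange K).sha), (∃ j : ℕ, 3 ^ j • c = 0) →
      3 ^ padicValNat 3 (AddSubgroup.zmultiples P).index • c = 0 :=
  Three.KolyvaginAnnihilator.pow_smul_sha_three_primary_eq_zero_of_classX11b_of_kodairaNeron_rat_index
    hW
    (poitouTate_sum_localTatePairing_eq_zero_holds K) hN
    (heegnerPointOfConductor_one_galoisConj_holds N W K) (KolyvaginLeaves.hCM_holds N W K 3)
    (@fun _ ↦ KolyvaginLeaves.h53_holds hN 3) hKN3m hKN3a hγ

/-- **On the class X11b @ 3 ∩ (KN₃)/ℚ: `3 ∤ y_K` in `E(K)` ⟹ `Ш(E/K)[3^∞] = 0`** (Gross 1991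
Prop. 2.1 (2) at `p = 3`) — modulo ONE cite-only input `hγ` at `3`.  The tree END
`Three.sha_three_primary_eq_zero_of_classX11b_of_kodairaNeron_rat_of_not_dvd` with `hPT`, `hrec`,
`hCM`, `h53` SUPPLIED by the tree theorems; binders/conclusion otherwise VERBATIM.  CONDITIONAL on
EXACTLY {`hγ`} at `3` + `hN` + (KN₃)/ℚ; nothing booked; no mark.
[cite: GrossLMS1991, Prop. 2.1 (2), §3 Prop. 3.7 (2), §10] [cite: McCallumLMS1991, §1 Theorem (Kolyvagin)] -/
theorem sha_three_primary_eq_zero_of_classX11b_of_kodairaNeron_rat_of_not_dvd [NeZero N]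
    [W.IsGloballyMinimal] (hW : ClassX11b W 3) (hN : ∀ [W.IsElliptic], N = W.conductorNorm ℤ)
    (hKN3m : ∀ [W.IsElliptic] (v : HeightOneSpectrum (𝓞 ℚ)),
      W.HasMultiplicativeReductionAt v → ¬ 3 ∣ W.ordMinimalDiscriminant v)
    (hKN3a : ∀ [W.IsElliptic] (v : HeightOneSpectrum (𝓞 ℚ)), W.HasAdditiveReductionAt v →
      W.kodairaSymbolAt v ≠ KodairaSymbol.IV ∧ W.kodairaSymbolAt v ≠ KodairaSymbol.IVstar)
    (hγ : ∀ [W.IsElliptic] (_hK : IsImaginaryQuadratic K) (_hH : SatisfiesHeegnerHypothesis N K)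
      (Dt : ModularParametrizationData W N) (β : ℤ) (ι : K →+* ℂ) {M : ℕ}
      (_hM : 1 ≤ M) {n : ℕ} (_hn : Squarefree n)
      (_hKol : ∀ q ∈ n.primeFactors, IsKolyvaginPrime N W K 3 q ∧ FrobEqFrobInfty W K (3 ^ M) q)
      (d : (m : ℕ) → m ∣ n → KolyvaginHeegnerData Dt β ι m)
      (m : ℕ) (hm : m ∣ n) (ℓ : ℕ) (hℓ : ℓ ∈ m.primeFactors) [Fact ℓ.Prime]
      (hΔ : ¬ (ℓ : ℤ) ∣ minimalDiscriminantInt W) (φ₀ : absoluteGaloisGroup (ZMod ℓ)),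
      (∀ x : AlgebraicClosure (ZMod ℓ), φ₀ • x = x ^ ℓ) →
      ∀ (hle : ringClassField K ι (m / ℓ) ≤ ringClassField K ι m)
        (γ : ringClassField K ι m ≃ₐ[ℚ] ringClassField K ι m), γ ∈ ringClassGal ι m →
        geomReduction hΔ ((RatClosure.pointsEquiv (K := K) W).symm
            ((d m hm).toGeomPoints (pointGalHom W (ringClassField K ι m) γ (d m hm).y))) =
          φ₀ • geomReduction hΔ ((RatClosure.pointsEquiv (K := K) W).symm
            ((d m hm).toGeomPoints (pointGalHom W (ringClassField K ι m) γ
              (WeierstrassCurve.Affine.Point.map (W' := W)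
                ((RingClassField.inclusion ι hle).restrictScalars ℚ)
                (d (m / ℓ)
                  ((Nat.div_dvd_of_dvd (Nat.dvd_of_mem_primeFactors hℓ)).trans hm)).y))))) :
    ∀ [W.IsElliptic] (_hK : IsImaginaryQuadratic K) (_hH : SatisfiesHeegnerHypothesis N K)
      {P : (W.baseChange K).toAffine.Point} (_hP : IsHeegnerPoint N W K P)
      (_hnt : ¬ IsOfFinAddOrder P)
      (_h3 : ∀ Q : (W.baseChange K).toAffine.Point, 3 • Q ≠ P) (c : (W.baseChange K).sha),
      (∃ j : ℕ, 3 ^ j • c = 0) → c = 0 :=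
  Three.sha_three_primary_eq_zero_of_classX11b_of_kodairaNeron_rat_of_not_dvd hW
    (poitouTate_sum_localTatePairing_eq_zero_holds K) hN
    (heegnerPointOfConductor_one_galoisConj_holds N W K) (KolyvaginLeaves.hCM_holds N W K 3)
    (@fun _ ↦ KolyvaginLeaves.h53_holds hN 3) hKN3m hKN3a hγ

end Summit.BirchSwinnertonDyer.Rank1Residual.X11b.Three.KolyvaginDischarged

end
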